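/-
Copyright (c) 2026 the pub-hodgecm-mathlib formalisation cell (harness21).  Prover seat hodgecm-mathlib-LH4-p05 (g9), FLOOR 0, SUPPORTS-ONLY on h413; β-BOARD v1 row R8 ∕ R10
«H-LINE JUNCTION» (β chair F0P3a-p01 (g37) LEDGER #15 (3), dealer∕pen LH4-plan (g14) WORD #127): the `hH` binder of the rest assembly `restSum_eq_of_rows` FROM the R8 row heads.
2026-09-04.
-/
import Summits.HodgeConjecture.HodgeConjecture.Theorems.F0P3cDyRamLabelledOddCoreHangingShell        -- ★ p861362 (LH7-p08 (g0), R8 FILE 1): the token-free zero off `2ρ + ℓ₀ = min n₁ n₂`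
import Summits.HodgeConjecture.HodgeConjecture.Theorems.F0P3cDyRamLabelledOddCoreHangingDeepSum      -- ★ p861620 (LH7-p08 (g0), R8 FILE 3b): the H row, deep key `(m, m, L)`
import Summits.HodgeConjecture.HodgeConjecture.Theorems.F0P3cDyRamLabelledOddCoreHangingDeepSumTwo   -- ★ (LH7-p08 (g0), R8 FILE 3d): the H row, deep key `(m, L, m)`
import Summits.HodgeConjecture.HodgeConjecture.Theorems.F0P3cDyRamLabelledOddCoreHangingDeepSumOne   -- ★ (LH7-p08 (g0), R8 FILE 3f): the H row, deep key `(L, m, m)`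
import Summits.HodgeConjecture.HodgeConjecture.Theorems.F0P3cDyRamTowerSignRelationsDeep            -- ★ p861198 (LH7-p08 (g0)): RELATIONS I–III in element-datum form
import Summits.HodgeConjecture.HodgeConjecture.Theorems.F0P3cDyRamElementDatumParity                -- ★ (LH4-p10 (g2)): `isoceles_of_isElementDatum`, `depth_mod_two_eq_of_isElementDatum`
import Summits.HodgeConjecture.HodgeConjecture.Theorems.F0P3cDyRamLabelledOddCoreHangingEquilateralOffWindow  -- ★ p862023 (LH7-p05 (g0), R8-EQ FILE EQ-1): equilateral key OFF the window (ED. 2)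
import HarnessLib

/-!
# Crux `H413`, LH4 «(D-RAM) FOUR-FRAME» road, STAGE 1b (β) — THE H-LINE JUNCTION: the hanging-line binder `hH` of the rest assembly, `v_i(2ρ, 2ρ, 2ρ) = VH ρ` with
# `VH` THE CLOSED FORM OF RECORD (LH4-p10 (g6) `harith_of_values`' `hVH0 ∕ hVH1`), FROM the R8 row heads — ★ rows plugged by name, pending rows carried as binders

Cell `hodgecm-mathlib` (D-0151), FLOOR 0, crux item H413 = `stmt-HodgeConjecture-24833`, route `HCCMUnconditional`; squad F0∕P3c∕LH4.  THEOREMS ONLY (no `def`, no instance, no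
notation, no `sorry`, default heartbeats); ★-only imports; lane `--supports stmt-HodgeConjecture-24833 --as helper` (count-neutral; pays NO row, states NO law).

WHAT THIS FILE DOES.  F0P3a-p01 (g37)'s rest assembly `…OddLabelledRestAssembly.restSum_eq_of_rows` (β-BOARD R10) takes the hanging line as ONE binder
`hH : ∀ ρ, 1 ≤ ρ → 2ρ ≤ n₁ + n₂ + n₃ → v_i(H ρ) = VH ρ`, where `v_i(H ρ)` is the labelled-odd table of the clean-shell cut of the core-hanging stratum `H(ρ) = (2ρ, 2ρ, 2ρ)` in
slot `i` and — by the chair's ruling LEDGER #15 (1) — `VH` IS LH4-p10 (g6)'s closed form (`harith_of_values`, letters `hVH0 ∕ hVH1`): `VH ρ = 0` off the locus `2ρ + ℓ₀ = min n₁ n₂`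
(`ℓ₀ = d % 2`) and, on it, the vector
`( [n₂ = n₃]·(ω_A + ω_m ω_C)∕4 · q^{n₂−ℓ₀−1} · ((q−2)[n₂ + 2d ≤ n₁] − 2[n₁ + 2 = n₂ + 2d]),  [n₁ = n₃]·(ω_B + ω_C)∕4 · q^{n₁−ℓ₀−1} · ((q−2)[n₁ + 2d ≤ n₂] − 2[n₂ + 2 = n₁ + 2d]),`
`  [n₁ = n₂]·(ω_m ω_B + ω_m ω_A)∕4 · q^{n₁−ℓ₀−1} · ((q−2)[n₁ + 2d ≤ n₃] − 2[n₃ + 2 = n₁ + 2d]) )_i`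
(`q = #𝓀`, `ω = normSign σ`, `ω_X = ω(e_X)` for the tower-sign tokens `e_A, e_B, e_C` of `α − 1, β − 1, β − α`, `ω_m = ω(−1)`; LH7-p08 (g0) H-ROW DERIVATION v1 §4, LH4-cdis1 (g0) fork (a) at
`q = 4`).  The head `hangingValue_of_rows` proves exactly that binder, by cases on the isosceles key (★ `isoceles_of_isElementDatum`; parities ★ `depth_mod_two_eq_of_isElementDatum`):
* off the locus (non-equilateral key): ★ p861362 `finsum_stratum_H_shell_labelledOdd_div_relIndex_eq_zero_of_ne` (the shell cut is empty);
* on the locus, DEEP third root (`m + 2d ≤ L`): ★ p861620 `…_eq_of_deep₃` (key `(m, m, L)`, slot 2), ★ `…_eq_of_deep₂` (key `(m, L, m)`, slot 1), ★ `…_eq_of_deep₁` (key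
  `(L, m, m)`, slot 0) — LH7-p08 (g0) R8 FILES 3b ∕ 3d ∕ 3f — each ONE-TOKEN value converted to the SYMMETRIC token pair of the closed form by ★ RELATIONS I ∕ II ∕ III
  (`…TowerSignRelationsDeep.normSign_towerSign_eq_of_isElementDatum_of_deep₃ ∕ ₂ ∕ ₁` — legitimate exactly there: the deep letter is their hypothesis);
* on the locus, BOUNDARY third root (`L + 2 = m + 2d`, three placements) and SHALLOW third root (`L + 4 ≤ m + 2d`, three placements): NOT yet ★ — carried as the binders
  `hB₃ hB₂ hB₁` (value `−(pair)∕2 · q^{2ρ−1}` in the special slot, `0` elsewhere) and `hZ₃ hZ₂ hZ₁` (value `0`), LH7-p08 (g0)'s announced shapes (memo §3∕§4: `H = −S`, resp. `0`);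
* the EQUILATERAL key `n₁ = n₂ = n₃` (there the closed form is `0` in every slot): carried as the binder `hEq` — the per-stratum zero (β chair LEDGER #15 (1) ⚠: if R8-EQ lands only the
  TOTAL over `ρ`, that key is routed through `restSum_eq_of_rows` with its own `harith` and this binder is not used).
The remaining arithmetic (exponent `n − ℓ₀ − 1 = 2ρ − 1` on the locus, `Nat.card = Fintype.card`, the dead brackets `[m + 2d ≤ m]`, `[m + 2 = m + 2d]` for `d ≥ 2` —
★ `two_le_d_of_v_two_lt_one`) is `fin_cases i; simp; ring`.
HONEST LABEL.  Count-neutral junction; the binders `hEq hB₃ hB₂ hB₁ hZ₃ hZ₂ hZ₁` are OPEN R8 rows (LH7-p08∕p09 (g0)); `hH`, `hRest`, (β), T₊ OPEN; `HC_CM` is proved only modulo the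
7 printed citations (2 remaining named inputs: hLiu418 = `stmt-HodgeConjecture-24832`, h413 = `stmt-HodgeConjecture-24833`) until rung 0 closes.

## References
* [Kottwitz1986BaseChangeUnits] R. E. Kottwitz, *Base change for unit elements of Hecke algebras*, Compositio Math. 60 (1986), §1 pp. 240–241 (signed lattice counts modulo the torus).
* [Rogawski1990] J. D. Rogawski, *Automorphic Representations of Unitary Groups in Three Variables*, Ann. of Math. Stud. 123 (1990), §4.9 Prop. 4.9.1 (a)(b) p. 55, §4.10 p. 58.
* [LanglandsShelstad1987] R. P. Langlands, D. Shelstad, *On the definition of transfer factors*, Math. Ann. 278 (1987), §3.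
-/

set_option autoImplicit false

noncomputable section

namespace Summit.HodgeConjecture.HodgeConjecture.Cruxes.H413.F0P3cDyRamOddLabelledHangingLine

open Literature.NumberTheory.Automorphic Literature.NumberTheory.Automorphic.HermitianLattice Literature.NumberTheory.Automorphic.UnitaryGroup
open Literature.NumberTheory.Automorphic.UnitaryLatticeTree Literature.NumberTheory.Automorphic.UnitaryThreeFourFrame
open Summit.HodgeConjecture.HodgeConjecture.Cruxes.H413.F0P3cDyRamFourFramePieces
open Summit.HodgeConjecture.HodgeConjecture.Cruxes.H413.F0P3cDyRamFourFrameCensusDefs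
open Summit.HodgeConjecture.HodgeConjecture.Cruxes.H413.F0P3cDyRamStageOneBDefs
open Summit.HodgeConjecture.HodgeConjecture.Cruxes.H413.F0P3cDyRamDiagonalTorusDefs
open Summit.HodgeConjecture.HodgeConjecture.Cruxes.H413.F0P3cDyRamDiagonalStrataDefs
open Summit.HodgeConjecture.HodgeConjecture.Cruxes.H413.F0P3cDyRamLabelledOddCountDefs
open Summit.HodgeConjecture.HodgeConjecture.Cruxes.H413.F0P3cDyRamLabelledOddCoreHangingShell (finsum_stratum_H_shell_labelledOdd_div_relIndex_eq_zero_of_ne)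
open Summit.HodgeConjecture.HodgeConjecture.Cruxes.H413.F0P3cDyRamLabelledOddCoreHangingDeepSum (finsum_stratum_H_shell_labelledOdd_div_relIndex_eq_of_deep₃)
open Summit.HodgeConjecture.HodgeConjecture.Cruxes.H413.F0P3cDyRamLabelledOddCoreHangingDeepSumTwo (finsum_stratum_H_shell_labelledOdd_div_relIndex_eq_of_deep₂)
open Summit.HodgeConjecture.HodgeConjecture.Cruxes.H413.F0P3cDyRamLabelledOddCoreHangingDeepSumOne (finsum_stratum_H_shell_labelledOdd_div_relIndex_eq_of_deep₁)
open Summit.HodgeConjecture.HodgeConjecture.Cruxes.H413.F0P3cDyRamTowerSignRelationsDeep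
open Summit.HodgeConjecture.HodgeConjecture.Cruxes.H413.F0P3cDyRamElementDatumParity (isoceles_of_isElementDatum depth_mod_two_eq_of_isElementDatum)
open Summit.HodgeConjecture.HodgeConjecture.Cruxes.H413.F0P3cDyRamLabelledOddCoreHangingEquilateralOffWindow
open Summit.HodgeConjecture.HodgeConjecture.Cruxes.H413.F0P3cDyRamDiagonalKappaCoreHangingClass (two_le_d_of_v_two_lt_one)
open scoped Valued WithZero Matrix MatrixGroups

variable {K : Type} [Field K] [Valued K ℤᵐ⁰] {σ : K →+* K} {ϖ : K} {d t : ℕ} {α β : K} {N₀ n₁ n₂ n₃ : ℕ}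

/-- **THE H-LINE JUNCTION — `hH` OF THE REST ASSEMBLY FROM THE R8 ROW HEADS.**  Ramified datum on a complete field with finite residue field `q = #𝓀`, `|2| < 1`; element datum
`(α, β; n₁, n₂, n₃)` at a threshold `N₀` with `mcOfRecord d ≤ N₀`, `d ≤ N₀`; `T = diag(α, β, 1)`; tower-sign tokens `e_A, e_B, e_C` of `α − 1` (depth `n₂`), `β − 1` (depth `n₁`),
`β − α` (depth `n₃`) — the (T2) trunk's `hRest` token letters VERBATIM.  Given the pending R8 rows as binders — `hEq` (equilateral key, per-stratum zero), `hB₃ ∕ hB₂ ∕ hB₁`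
(boundary keys `L + 2 = m + 2d`: `−(token pair)∕2 · q^{2ρ−1}` in the special slot), `hZ₃ ∕ hZ₂ ∕ hZ₁` (shallow keys `L + 4 ≤ m + 2d`: zero) — for every slot `i` and every
`ρ ≥ 1` with `2ρ ≤ n₁ + n₂ + n₃`:
`Σᶠ_{M ∈ stratum σ ϖ T (2ρ,2ρ,2ρ), clean shell} labelledOddCount σ ϖ 0 i Λ M ∕ [𝒰 : N(S̃′(M))] = if 2ρ + d % 2 = min n₁ n₂ then W_i else 0`, `W` = LH4-p10 (g6)'s `hVH1` vector at
`q := Fintype.card 𝓀[K]`, `ω_X := normSign σ e_X`, `ω_m := normSign σ (−1)` (so the assembly's `VH := fun ρ => if … then W_i else 0` has `hVH0 ∕ hVH1` by `if_neg ∕ if_pos`).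
★ rows used by name: p861362 (off-locus zero), p861620 (deep₃), `…DeepSumTwo` (deep₂), `…DeepSumOne` (deep₁), p861198 RELATIONS I–III.
[cite: Kottwitz1986BaseChangeUnits, §1 pp. 240–241] [cite: Rogawski1990, §4.9 Prop. 4.9.1 (a)(b) p. 55, §4.10 p. 58] [cite: LanglandsShelstad1987, §3] -/
theorem hangingValue_of_rows [CompleteSpace K] [Fintype 𝓀[K]] (h2 : Valued.v (2 : K) < 1) (hD : IsRamifiedQuadraticDatum σ ϖ d t)
    (hE : IsElementDatum σ ϖ N₀ α β n₁ n₂ n₃) (hmc : mcOfRecord d ≤ N₀) (hdN₀ : d ≤ N₀)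
    (T : GL (Fin 3) K) (hT : (T : Matrix (Fin 3) (Fin 3) K) = Matrix.diagonal ![α, β, 1])
    {eA eB eC : K} (hσeA : σ eA = eA) (heA1 : Valued.v eA = 1)
    (heA : Valued.v ((ϖ ^ mstarOfRecord d)⁻¹ * ((α - 1) * ((ϖ * σ ϖ) ^ ((n₂ - d % 2) / 2))⁻¹ - eA * ((ϖ - σ ϖ) * ((ϖ * σ ϖ) ^ ((d - d % 2) / 2))⁻¹))) ≤ 1)
    (hσeB : σ eB = eB) (heB1 : Valued.v eB = 1)
    (heB : Valued.v ((ϖ ^ mstarOfRecord d)⁻¹ * ((β - 1) * ((ϖ * σ ϖ) ^ ((n₁ - d % 2) / 2))⁻¹ - eB * ((ϖ - σ ϖ) * ((ϖ * σ ϖ) ^ ((d - d % 2) / 2))⁻¹))) ≤ 1)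
    (hσeC : σ eC = eC) (heC1 : Valued.v eC = 1)
    (heC : Valued.v ((ϖ ^ mstarOfRecord d)⁻¹ * ((β - α) * ((ϖ * σ ϖ) ^ ((n₃ - d % 2) / 2))⁻¹ - eC * ((ϖ - σ ϖ) * ((ϖ * σ ϖ) ^ ((d - d % 2) / 2))⁻¹))) ≤ 1)
    (hEq : n₁ = n₂ → n₂ = n₃ → ∀ ρ : ℕ, 1 ≤ ρ → 2 * ρ ≤ n₁ + n₂ + n₃ → ∀ i : Fin 3,
      ∑ᶠ M ∈ {M : Submodule 𝒪[K] (Fin 3 → K) | M ∈ stratum σ ϖ T ![2 * ρ, 2 * ρ, 2 * ρ] ∧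
          (LatticeInLevel ϖ (d % 2) (Matrix.diagonal ![α - 1, β - 1, 0]) M ∧ ¬ LatticeInLevel ϖ (d % 2 + 1) (Matrix.diagonal ![α - 1, β - 1, 0]) M ∧
            LatticeInLevel ϖ (mcOfRecord d) (Matrix.diagonal ![(α - 1) * (α - 1), (β - 1) * (β - 1), 0]) M)},
        (labelledOddCount σ ϖ 0 i (valueClassLabel σ ϖ (α - 1) (β - 1) (mstarOfRecord d) d) M : ℚ) /
          ((((unitStabilizer M).map (unitNormMap σ 3)).relIndex (fixedUnitTorus σ 3) : ℕ) : ℚ) = 0)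
    (hB₃ : n₁ = n₂ → n₃ + 2 = n₁ + 2 * d → ∀ ρ : ℕ, 1 ≤ ρ → 2 * ρ + d % 2 = n₁ → ∀ i : Fin 3,
      ∑ᶠ M ∈ {M : Submodule 𝒪[K] (Fin 3 → K) | M ∈ stratum σ ϖ T ![2 * ρ, 2 * ρ, 2 * ρ] ∧
          (LatticeInLevel ϖ (d % 2) (Matrix.diagonal ![α - 1, β - 1, 0]) M ∧ ¬ LatticeInLevel ϖ (d % 2 + 1) (Matrix.diagonal ![α - 1, β - 1, 0]) M ∧
            LatticeInLevel ϖ (mcOfRecord d) (Matrix.diagonal ![(α - 1) * (α - 1), (β - 1) * (β - 1), 0]) M)},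
        (labelledOddCount σ ϖ 0 i (valueClassLabel σ ϖ (α - 1) (β - 1) (mstarOfRecord d) d) M : ℚ) /
          ((((unitStabilizer M).map (unitNormMap σ 3)).relIndex (fixedUnitTorus σ 3) : ℕ) : ℚ) =
        (((![0, 0, -(normSign σ (-1 : K) * normSign σ eB + normSign σ (-1 : K) * normSign σ eA)] : Fin 3 → ℤ) i : ℤ) : ℚ) / 2 * (Nat.card 𝓀[K] : ℚ) ^ (2 * ρ - 1))
    (hB₂ : n₁ = n₃ → n₂ + 2 = n₁ + 2 * d → ∀ ρ : ℕ, 1 ≤ ρ → 2 * ρ + d % 2 = n₁ → ∀ i : Fin 3,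
      ∑ᶠ M ∈ {M : Submodule 𝒪[K] (Fin 3 → K) | M ∈ stratum σ ϖ T ![2 * ρ, 2 * ρ, 2 * ρ] ∧
          (LatticeInLevel ϖ (d % 2) (Matrix.diagonal ![α - 1, β - 1, 0]) M ∧ ¬ LatticeInLevel ϖ (d % 2 + 1) (Matrix.diagonal ![α - 1, β - 1, 0]) M ∧
            LatticeInLevel ϖ (mcOfRecord d) (Matrix.diagonal ![(α - 1) * (α - 1), (β - 1) * (β - 1), 0]) M)},
        (labelledOddCount σ ϖ 0 i (valueClassLabel σ ϖ (α - 1) (β - 1) (mstarOfRecord d) d) M : ℚ) /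
          ((((unitStabilizer M).map (unitNormMap σ 3)).relIndex (fixedUnitTorus σ 3) : ℕ) : ℚ) =
        (((![0, -(normSign σ eB + normSign σ eC), 0] : Fin 3 → ℤ) i : ℤ) : ℚ) / 2 * (Nat.card 𝓀[K] : ℚ) ^ (2 * ρ - 1))
    (hB₁ : n₂ = n₃ → n₁ + 2 = n₂ + 2 * d → ∀ ρ : ℕ, 1 ≤ ρ → 2 * ρ + d % 2 = n₂ → ∀ i : Fin 3,
      ∑ᶠ M ∈ {M : Submodule 𝒪[K] (Fin 3 → K) | M ∈ stratum σ ϖ T ![2 * ρ, 2 * ρ, 2 * ρ] ∧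
          (LatticeInLevel ϖ (d % 2) (Matrix.diagonal ![α - 1, β - 1, 0]) M ∧ ¬ LatticeInLevel ϖ (d % 2 + 1) (Matrix.diagonal ![α - 1, β - 1, 0]) M ∧
            LatticeInLevel ϖ (mcOfRecord d) (Matrix.diagonal ![(α - 1) * (α - 1), (β - 1) * (β - 1), 0]) M)},
        (labelledOddCount σ ϖ 0 i (valueClassLabel σ ϖ (α - 1) (β - 1) (mstarOfRecord d) d) M : ℚ) /
          ((((unitStabilizer M).map (unitNormMap σ 3)).relIndex (fixedUnitTorus σ 3) : ℕ) : ℚ) =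
        (((![-(normSign σ eA + normSign σ (-1 : K) * normSign σ eC), 0, 0] : Fin 3 → ℤ) i : ℤ) : ℚ) / 2 * (Nat.card 𝓀[K] : ℚ) ^ (2 * ρ - 1))
    (hZ₃ : n₁ = n₂ → n₁ < n₃ → n₃ + 4 ≤ n₁ + 2 * d → ∀ ρ : ℕ, 1 ≤ ρ → 2 * ρ + d % 2 = n₁ → ∀ i : Fin 3,
      ∑ᶠ M ∈ {M : Submodule 𝒪[K] (Fin 3 → K) | M ∈ stratum σ ϖ T ![2 * ρ, 2 * ρ, 2 * ρ] ∧
          (LatticeInLevel ϖ (d % 2) (Matrix.diagonal ![α - 1, β - 1, 0]) M ∧ ¬ LatticeInLevel ϖ (d % 2 + 1) (Matrix.diagonal ![α - 1, β - 1, 0]) M ∧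
            LatticeInLevel ϖ (mcOfRecord d) (Matrix.diagonal ![(α - 1) * (α - 1), (β - 1) * (β - 1), 0]) M)},
        (labelledOddCount σ ϖ 0 i (valueClassLabel σ ϖ (α - 1) (β - 1) (mstarOfRecord d) d) M : ℚ) /
          ((((unitStabilizer M).map (unitNormMap σ 3)).relIndex (fixedUnitTorus σ 3) : ℕ) : ℚ) = 0)
    (hZ₂ : n₁ = n₃ → n₁ < n₂ → n₂ + 4 ≤ n₁ + 2 * d → ∀ ρ : ℕ, 1 ≤ ρ → 2 * ρ + d % 2 = n₁ → ∀ i : Fin 3,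
      ∑ᶠ M ∈ {M : Submodule 𝒪[K] (Fin 3 → K) | M ∈ stratum σ ϖ T ![2 * ρ, 2 * ρ, 2 * ρ] ∧
          (LatticeInLevel ϖ (d % 2) (Matrix.diagonal ![α - 1, β - 1, 0]) M ∧ ¬ LatticeInLevel ϖ (d % 2 + 1) (Matrix.diagonal ![α - 1, β - 1, 0]) M ∧
            LatticeInLevel ϖ (mcOfRecord d) (Matrix.diagonal ![(α - 1) * (α - 1), (β - 1) * (β - 1), 0]) M)},
        (labelledOddCount σ ϖ 0 i (valueClassLabel σ ϖ (α - 1) (β - 1) (mstarOfRecord d) d) M : ℚ) /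
          ((((unitStabilizer M).map (unitNormMap σ 3)).relIndex (fixedUnitTorus σ 3) : ℕ) : ℚ) = 0)
    (hZ₁ : n₂ = n₃ → n₂ < n₁ → n₁ + 4 ≤ n₂ + 2 * d → ∀ ρ : ℕ, 1 ≤ ρ → 2 * ρ + d % 2 = n₂ → ∀ i : Fin 3,
      ∑ᶠ M ∈ {M : Submodule 𝒪[K] (Fin 3 → K) | M ∈ stratum σ ϖ T ![2 * ρ, 2 * ρ, 2 * ρ] ∧
          (LatticeInLevel ϖ (d % 2) (Matrix.diagonal ![α - 1, β - 1, 0]) M ∧ ¬ LatticeInLevel ϖ (d % 2 + 1) (Matrix.diagonal ![α - 1, β - 1, 0]) M ∧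
            LatticeInLevel ϖ (mcOfRecord d) (Matrix.diagonal ![(α - 1) * (α - 1), (β - 1) * (β - 1), 0]) M)},
        (labelledOddCount σ ϖ 0 i (valueClassLabel σ ϖ (α - 1) (β - 1) (mstarOfRecord d) d) M : ℚ) /
          ((((unitStabilizer M).map (unitNormMap σ 3)).relIndex (fixedUnitTorus σ 3) : ℕ) : ℚ) = 0)
    (i : Fin 3) (ρ : ℕ) (hρ : 1 ≤ ρ) (hB : 2 * ρ ≤ n₁ + n₂ + n₃) :
    ∑ᶠ M ∈ {M : Submodule 𝒪[K] (Fin 3 → K) | M ∈ stratum σ ϖ T ![2 * ρ, 2 * ρ, 2 * ρ] ∧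
        (LatticeInLevel ϖ (d % 2) (Matrix.diagonal ![α - 1, β - 1, 0]) M ∧ ¬ LatticeInLevel ϖ (d % 2 + 1) (Matrix.diagonal ![α - 1, β - 1, 0]) M ∧
          LatticeInLevel ϖ (mcOfRecord d) (Matrix.diagonal ![(α - 1) * (α - 1), (β - 1) * (β - 1), 0]) M)},
      (labelledOddCount σ ϖ 0 i (valueClassLabel σ ϖ (α - 1) (β - 1) (mstarOfRecord d) d) M : ℚ) /
        ((((unitStabilizer M).map (unitNormMap σ 3)).relIndex (fixedUnitTorus σ 3) : ℕ) : ℚ) =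
      if 2 * ρ + d % 2 = min n₁ n₂ then
        (![if n₂ = n₃ then ((normSign σ eA : ℚ) + normSign σ (-1 : K) * normSign σ eC) / 4 * (Fintype.card 𝓀[K] : ℚ) ^ (n₂ - d % 2 - 1) *
              ((if n₂ + 2 * d ≤ n₁ then (Fintype.card 𝓀[K] : ℚ) - 2 else 0) - (if n₁ + 2 = n₂ + 2 * d then 2 else 0)) else 0,
           if n₁ = n₃ then ((normSign σ eB : ℚ) + normSign σ eC) / 4 * (Fintype.card 𝓀[K] : ℚ) ^ (n₁ - d % 2 - 1) *
              ((if n₁ + 2 * d ≤ n₂ then (Fintype.card 𝓀[K] : ℚ) - 2 else 0) - (if n₂ + 2 = n₁ + 2 * d then 2 else 0)) else 0,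
           if n₁ = n₂ then ((normSign σ (-1 : K) : ℚ) * normSign σ eB + normSign σ (-1 : K) * normSign σ eA) / 4 * (Fintype.card 𝓀[K] : ℚ) ^ (n₁ - d % 2 - 1) *
              ((if n₁ + 2 * d ≤ n₃ then (Fintype.card 𝓀[K] : ℚ) - 2 else 0) - (if n₃ + 2 = n₁ + 2 * d then 2 else 0)) else 0] : Fin 3 → ℚ) i
      else 0 := by
  classical
  -- letters of the datum
  have h2d : 2 ≤ d := two_le_d_of_v_two_lt_one hD h2
  have hiso := isoceles_of_isElementDatum hD hE
  obtain ⟨hp1, hp2, hp3⟩ := depth_mod_two_eq_of_isElementDatum hD hE hdN₀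
  have hq : (Nat.card 𝓀[K] : ℚ) = (Fintype.card 𝓀[K] : ℚ) := by rw [Nat.card_eq_fintype_card]
  have hsq : (normSign σ (-1 : K) : ℚ) * normSign σ (-1 : K) = 1 := by
    have h : normSign σ (-1 : K) * normSign σ (-1 : K) = 1 := by unfold normSign; split_ifs <;> norm_num
    exact_mod_cast h
  by_cases heq3 : n₁ = n₂ ∧ n₂ = n₃
  · -- the equilateral key: both sides vanish (`d ≥ 2` kills every bracket of the closed form)
    obtain ⟨h12, h23⟩ := heq3
    rw [hEq h12 h23 ρ hρ hB i]
    subst h12 h23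
    have F1 : ¬ (n₁ + 2 * d ≤ n₁) := by omega
    have F2 : ¬ (n₁ + 2 = n₁ + 2 * d) := by omega
    simp only [if_neg F1, if_neg F2, sub_self, mul_zero, ite_self]
    split_ifs
    · fin_cases i <;> rfl
    · rfl
  by_cases hloc : 2 * ρ + d % 2 = min n₁ n₂
  · rw [if_pos hloc]
    rcases hiso with ⟨h12, h13⟩ | ⟨h13, h12⟩ | ⟨h23, h21⟩
    · -- key (m, m, L): special slot 2
      have hlt : n₁ < n₃ := lt_of_le_of_ne h13 (fun h => heq3 ⟨h12, h12 ▸ h⟩)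
      subst h12
      have hloc' : 2 * ρ + d % 2 = n₁ := by rw [hloc, min_self]
      have hexp : n₁ - d % 2 - 1 = 2 * ρ - 1 := by omega
      have G : ¬ (n₁ = n₃) := by omega
      rcases (show n₁ + 2 * d ≤ n₃ ∨ n₃ + 2 = n₁ + 2 * d ∨ n₃ + 4 ≤ n₁ + 2 * d by omega) with hdeep | hbd | hz
      · -- deep: ★ p861620 + ★ RELATION I (`ω_B = ω_A`)
        have hBA : (normSign σ eB : ℚ) = normSign σ eA :=
          congrArg (fun z : ℤ => (z : ℚ)) (normSign_towerSign_eq_of_isElementDatum_of_deep₃ hD hE rfl hdeep hp1 hσeA heA1 hσeB heA heB)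
        rw [finsum_stratum_H_shell_labelledOdd_div_relIndex_eq_of_deep₃ hD h2 hE hmc rfl hdeep T hT ρ hρ hloc' hσeA heA1 hσeB heA heB i, hq, hBA]
        have F2 : ¬ (n₃ + 2 = n₁ + 2 * d) := by omega
        fin_cases i <;> simp [G, hdeep, F2, hexp]
        ring
      · -- boundary: binder `hB₃`
        rw [hB₃ rfl hbd ρ hρ hloc' i, hq]
        have F1 : ¬ (n₁ + 2 * d ≤ n₃) := by omega
        fin_cases i <;> simp [G, hbd, F1, hexp]
        ring
      · -- shallow: binder `hZ₃`
        rw [hZ₃ rfl hlt hz ρ hρ hloc' i]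
        have F1 : ¬ (n₁ + 2 * d ≤ n₃) := by omega
        have F2 : ¬ (n₃ + 2 = n₁ + 2 * d) := by omega
        fin_cases i <;> simp [G, F1, F2]
    · -- key (m, L, m): special slot 1
      have hlt : n₁ < n₂ := lt_of_le_of_ne h12 (fun h => heq3 ⟨h, h ▸ h13⟩)
      subst h13
      have hloc' : 2 * ρ + d % 2 = n₁ := by rw [hloc, min_eq_left hlt.le]
      have hexp : n₁ - d % 2 - 1 = 2 * ρ - 1 := by omega
      have G1 : ¬ (n₂ = n₁) := by omega
      have G2 : ¬ (n₁ = n₂) := by omega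
      rcases (show n₁ + 2 * d ≤ n₂ ∨ n₂ + 2 = n₁ + 2 * d ∨ n₂ + 4 ≤ n₁ + 2 * d by omega) with hdeep | hbd | hz
      · -- deep: ★ `…_of_deep₂` + ★ RELATION II (`ω_C = ω_B`)
        have hCB : (normSign σ eC : ℚ) = normSign σ eB :=
          congrArg (fun z : ℤ => (z : ℚ)) (normSign_towerSign_eq_of_isElementDatum_of_deep₂ hD hE rfl hdeep hp1 hσeB hσeC heC1 heB heC)
        rw [finsum_stratum_H_shell_labelledOdd_div_relIndex_eq_of_deep₂ hD h2 hE hmc rfl hdeep T hT ρ hρ hloc' hσeA heA1 hσeB heB1 heA heB i, hq, hCB]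
        have F2 : ¬ (n₂ + 2 = n₁ + 2 * d) := by omega
        fin_cases i <;> simp [G1, G2, hdeep, F2, hexp]
        ring
      · -- boundary: binder `hB₂`
        rw [hB₂ rfl hbd ρ hρ hloc' i, hq]
        have F1 : ¬ (n₁ + 2 * d ≤ n₂) := by omega
        fin_cases i <;> simp [G1, G2, hbd, F1, hexp]
        ring
      · -- shallow: binder `hZ₂`
        rw [hZ₂ rfl hlt hz ρ hρ hloc' i]
        have F1 : ¬ (n₁ + 2 * d ≤ n₂) := by omega
        have F2 : ¬ (n₂ + 2 = n₁ + 2 * d) := by omega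
        fin_cases i <;> simp [G1, G2, F1, F2]
    · -- key (L, m, m): special slot 0
      have hlt : n₂ < n₁ := lt_of_le_of_ne h21 (fun h => heq3 ⟨h.symm, h23⟩)
      subst h23
      have hloc' : 2 * ρ + d % 2 = n₂ := by rw [hloc, min_eq_right hlt.le]
      have hexp : n₂ - d % 2 - 1 = 2 * ρ - 1 := by omega
      have G1 : ¬ (n₁ = n₂) := by omega
      rcases (show n₂ + 2 * d ≤ n₁ ∨ n₁ + 2 = n₂ + 2 * d ∨ n₁ + 4 ≤ n₂ + 2 * d by omega) with hdeep | hbd | hz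
      · -- deep: ★ `…_of_deep₁` (R8 FILE 3f) + ★ RELATION III (`ω_C = ω_m·ω_A`, so `ω_m·ω_C = ω_A`)
        have hmC : (normSign σ (-1 : K) : ℚ) * normSign σ eC = normSign σ eA := by
          have h := congrArg (fun z : ℤ => (z : ℚ)) (normSign_towerSign_eq_of_isElementDatum_of_deep₁ hD hE rfl hdeep hp2 hσeA heA1 hσeC heA heC)
          simp only [Int.cast_mul] at h
          rw [h, ← mul_assoc, hsq, one_mul]
        rw [finsum_stratum_H_shell_labelledOdd_div_relIndex_eq_of_deep₁ hD h2 hE hmc rfl hdeep T hT ρ hρ hloc' hσeA heA1 hσeB heB1 heA heB i, hq, hmC]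
        have F2 : ¬ (n₁ + 2 = n₂ + 2 * d) := by omega
        fin_cases i <;> simp [G1, hdeep, F2, hexp]
        ring
      · -- boundary: binder `hB₁`
        rw [hB₁ rfl hbd ρ hρ hloc' i, hq]
        have F1 : ¬ (n₂ + 2 * d ≤ n₁) := by omega
        fin_cases i <;> simp [G1, hbd, F1, hexp]
        ring
      · -- shallow: binder `hZ₁`
        rw [hZ₁ rfl hlt hz ρ hρ hloc' i]
        have F1 : ¬ (n₂ + 2 * d ≤ n₁) := by omega
        have F2 : ¬ (n₁ + 2 = n₂ + 2 * d) := by omega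
        fin_cases i <;> simp [G1, F1, F2]
  · -- off the locus: ★ p861362 (the shell cut of `H(ρ)` is empty on a non-equilateral key)
    rw [if_neg hloc]
    exact finsum_stratum_H_shell_labelledOdd_div_relIndex_eq_zero_of_ne hD hE hmc heq3 T ρ hρ hloc i


/-! ## §2 (ED. 2)  The equilateral socket `hEq` narrowed to the WINDOW — ★ p862023 (LH7-p05 (g0), R8-EQ FILE EQ-1) pays the off-window part by name -/

/-- **THE EQUILATERAL SOCKET FROM ITS WINDOW.**  On the equilateral key `n₁ = n₂ = n₃` the clean-shell cut of `H(ρ)` is EMPTY off the window `n₂ ≤ 2ρ + ℓ₀ ∧ 2ρ + mcOfRecord d ≤ 2n₂`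
(★ p862023 `…_of_equilateral_below` ∕ `…_of_equilateral_top`), so the junction's binder `hEq` (per-stratum zero for every `ρ ≥ 1`, `2ρ ≤ n₁ + n₂ + n₃`) follows from the same zero
ON the window alone — the binder `hEqW` (R8-EQ-a∕b, LH7-p08 ∕ LH7-p05 (g0), β chair LEDGER #17).  Output type = `hangingValue_of_rows`'s `hEq` VERBATIM.
[cite: Kottwitz1986BaseChangeUnits, §1 pp. 240–241] [cite: Rogawski1990, §4.9 Prop. 4.9.1 (a)(b) p. 55] -/
theorem equilateral_zero_of_window (hD : IsRamifiedQuadraticDatum σ ϖ d t) (hE : IsElementDatum σ ϖ N₀ α β n₁ n₂ n₃) (hmc : mcOfRecord d ≤ N₀)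
    (T : GL (Fin 3) K)
    (hEqW : n₁ = n₂ → n₂ = n₃ → ∀ ρ : ℕ, 1 ≤ ρ → n₂ ≤ 2 * ρ + d % 2 → 2 * ρ + mcOfRecord d ≤ 2 * n₂ → ∀ i : Fin 3,
      ∑ᶠ M ∈ {M : Submodule 𝒪[K] (Fin 3 → K) | M ∈ stratum σ ϖ T ![2 * ρ, 2 * ρ, 2 * ρ] ∧
          (LatticeInLevel ϖ (d % 2) (Matrix.diagonal ![α - 1, β - 1, 0]) M ∧ ¬ LatticeInLevel ϖ (d % 2 + 1) (Matrix.diagonal ![α - 1, β - 1, 0]) M ∧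
            LatticeInLevel ϖ (mcOfRecord d) (Matrix.diagonal ![(α - 1) * (α - 1), (β - 1) * (β - 1), 0]) M)},
        (labelledOddCount σ ϖ 0 i (valueClassLabel σ ϖ (α - 1) (β - 1) (mstarOfRecord d) d) M : ℚ) /
          ((((unitStabilizer M).map (unitNormMap σ 3)).relIndex (fixedUnitTorus σ 3) : ℕ) : ℚ) = 0) :
    n₁ = n₂ → n₂ = n₃ → ∀ ρ : ℕ, 1 ≤ ρ → 2 * ρ ≤ n₁ + n₂ + n₃ → ∀ i : Fin 3,
      ∑ᶠ M ∈ {M : Submodule 𝒪[K] (Fin 3 → K) | M ∈ stratum σ ϖ T ![2 * ρ, 2 * ρ, 2 * ρ] ∧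
          (LatticeInLevel ϖ (d % 2) (Matrix.diagonal ![α - 1, β - 1, 0]) M ∧ ¬ LatticeInLevel ϖ (d % 2 + 1) (Matrix.diagonal ![α - 1, β - 1, 0]) M ∧
            LatticeInLevel ϖ (mcOfRecord d) (Matrix.diagonal ![(α - 1) * (α - 1), (β - 1) * (β - 1), 0]) M)},
        (labelledOddCount σ ϖ 0 i (valueClassLabel σ ϖ (α - 1) (β - 1) (mstarOfRecord d) d) M : ℚ) /
          ((((unitStabilizer M).map (unitNormMap σ 3)).relIndex (fixedUnitTorus σ 3) : ℕ) : ℚ) = 0 := by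
  intro h12 h23 ρ hρ _ i
  by_cases hbelow : 2 * ρ + d % 2 < n₂
  · exact finsum_stratum_H_shell_labelledOdd_div_relIndex_eq_zero_of_equilateral_below hD hE hmc T ρ hρ h12 h23 hbelow i
  by_cases htop : 2 * n₂ < 2 * ρ + mcOfRecord d
  · exact finsum_stratum_H_shell_labelledOdd_div_relIndex_eq_zero_of_equilateral_top hD hE hmc T ρ hρ h12 h23 htop i
  exact hEqW h12 h23 ρ hρ (not_lt.mp hbelow) (not_lt.mp htop) i

end Summit.HodgeConjecture.HodgeConjecture.Cruxes.H413.F0P3cDyRamOddLabelledHangingLine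

end
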